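import Summits.QuantumAdvantage.AdviceFreeQNC0.BlockAdditiveMoves
import HarnessLib

/-!
# Cell qa-qnc0 (rung F-Q1, route RingFrame, crux α, line `product`): block-additive maps — the
# characteristic-2 THREE-CYCLE (qn-p1 TARGET §20.8, ask P6e; PROVER-MEMO-gen4 §2 step (2))

The algebraic core of the τ''-free proof of `Sketch8b.BlockAdditiveFSB`, PROVED:

* `incr_cycle`: inside one block the increments of the three type-1 moves `x → y → z → x` sum to
  zero: `Δ(x,y) ⊕ Δ(y,z) ⊕ Δ(z,x) = 0` (telescoping in characteristic 2);
* `cnorm_xor_lt_of_common_partner`: two moves with a COMMON good partner on a third block have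
  `‖Δ(a) ⊕ Δ(a')‖ < 4θ·2^{L'}`;
* `cnorm_lt_of_cycle_partners`: if a move `m` shares a good partner with each of the three moves of a
  three-cycle, then `‖Δ(m)‖ < 12θ·2^{L'}` — because
  `Δm = (Δm ⊕ Δ₁) ⊕ (Δm ⊕ Δ₂) ⊕ (Δm ⊕ Δ₃)` when `Δ₁ ⊕ Δ₂ ⊕ Δ₃ = 0` (`3Δm = Δm`);
* `far_bmove_of_cnorm_lt`: a move with increment of norm `< (c−1)θ·2^{L'}` applied to a `cθ`-far
  row lands on a `θ`-far row (the landing step of memo §2 (3)).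

What remains for `BlockAdditiveFSB` (next prover): the COUNTING that supplies the partners and the
cycle from `card_badPairs_le` (`BlockAdditivePairs.lean`) by Markov, and the landing double count.
WHAT THIS IS NOT: nothing on FSB/FW at general column degree, nothing on α; no separation claim.
-/

noncomputable section

namespace Summit.QuantumAdvantage.AdviceFreeQNC0

open Finset
open Literature.Computability.MetaComplexity Literature.Computability.MetaComplexity.Smolensky

namespace BlockAdditive

variable {L L' k : ℕ}

/-- **The three-cycle telescopes**: `Δ(x,y) ⊕ Δ(y,z) ⊕ Δ(z,x) = 0`. -/
theorem incr_cycle (G : Fin k → (Fin L → Bool) → (Fin L' → Bool) → Bool) (i : Fin k)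
    (x y z : Fin L → Bool) (v : Fin L' → Bool) :
    xor (xor (incr G i x y v) (incr G i y z v)) (incr G i z x v) = false := by
  unfold incr
  cases G i x v <;> cases G i y v <;> cases G i z v <;> rfl

/-- **Two moves with a common good partner have close increments**: `‖Δ(a) ⊕ Δ(a')‖ < 4θ·2^{L'}`. -/
theorem cnorm_xor_lt_of_common_partner {blk : Fin L → Fin k}
    {G : Fin k → (Fin L → Bool) → (Fin L' → Bool) → Bool} (hG : BlockLocal blk G) {D : ℕ} {θ : ℝ}
    {a a' b : Mv L k} (hab : a.1 ≠ b.1) (ha'b : a'.1 ≠ b.1)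
    (h : Good blk G D θ a b) (h' : Good blk G D θ a' b) :
    (cnorm D (fun v => xor (incrM G a v) (incrM G a' v)) : ℝ) < 4 * θ * (2 : ℝ) ^ L' := by
  have h1 := cnorm_pair_lt_of_good hG hab h
  have h2 := cnorm_pair_lt_of_good hG ha'b h'
  have h3 := cnorm_xor_le D (fun v => xor (incrM G a v) (incrM G b v))
    (fun v => xor (incrM G a' v) (incrM G b v))
  have e : (fun v => xor (xor (incrM G a v) (incrM G b v)) (xor (incrM G a' v) (incrM G b v))) =
      fun v => xor (incrM G a v) (incrM G a' v) := by
    funext v; cases incrM G a v <;> cases incrM G a' v <;> cases incrM G b v <;> rfl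
  rw [e] at h3
  have h3' : (cnorm D (fun v => xor (incrM G a v) (incrM G a' v)) : ℝ) ≤
      (cnorm D (fun v => xor (incrM G a v) (incrM G b v)) : ℝ) +
        (cnorm D (fun v => xor (incrM G a' v) (incrM G b v)) : ℝ) := by exact_mod_cast h3
  linarith

/-- **The three-cycle bound**: if `‖Δm ⊕ Δ_t‖ < 4θ·2^{L'}` for the three moves of a three-cycle
`x → y → z → x` in one block, then `‖Δm‖ < 12θ·2^{L'}` (`Δm = ⨁_t (Δm ⊕ Δ_t)` in characteristic 2). -/
theorem cnorm_lt_of_cycle {G : Fin k → (Fin L → Bool) → (Fin L' → Bool) → Bool} {D : ℕ} {θ : ℝ}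
    (m : Mv L k) (i : Fin k) (x y z : Fin L → Bool)
    (h1 : (cnorm D (fun v => xor (incrM G m v) (incrM G (i, x, y) v)) : ℝ) < 4 * θ * (2 : ℝ) ^ L')
    (h2 : (cnorm D (fun v => xor (incrM G m v) (incrM G (i, y, z) v)) : ℝ) < 4 * θ * (2 : ℝ) ^ L')
    (h3 : (cnorm D (fun v => xor (incrM G m v) (incrM G (i, z, x) v)) : ℝ) < 4 * θ * (2 : ℝ) ^ L') :
    (cnorm D (incrM G m) : ℝ) < 12 * θ * (2 : ℝ) ^ L' := by
  have e : incrM G m = fun v => xor (xor (xor (incrM G m v) (incrM G (i, x, y) v))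
      (xor (incrM G m v) (incrM G (i, y, z) v))) (xor (incrM G m v) (incrM G (i, z, x) v)) := by
    funext v
    have hc := incr_cycle G i x y z v
    unfold incrM at hc ⊢
    simp only at hc ⊢
    revert hc
    cases incr G m.1 m.2.1 m.2.2 v <;> cases incr G i x y v <;> cases incr G i y z v <;>
      cases incr G i z x v <;> decide
  have h4 := cnorm_xor_le D (fun v => xor (incrM G m v) (incrM G (i, x, y) v))
    (fun v => xor (incrM G m v) (incrM G (i, y, z) v))
  have h5 := cnorm_xor_le D
    (fun v => xor (xor (incrM G m v) (incrM G (i, x, y) v)) (xor (incrM G m v) (incrM G (i, y, z) v)))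
    (fun v => xor (incrM G m v) (incrM G (i, z, x) v))
  rw [← e] at h5
  have h4' : (cnorm D (fun v => xor (xor (incrM G m v) (incrM G (i, x, y) v))
      (xor (incrM G m v) (incrM G (i, y, z) v))) : ℝ) ≤
      (cnorm D (fun v => xor (incrM G m v) (incrM G (i, x, y) v)) : ℝ) +
        (cnorm D (fun v => xor (incrM G m v) (incrM G (i, y, z) v)) : ℝ) := by exact_mod_cast h4
  have h5' : (cnorm D (incrM G m) : ℝ) ≤
      (cnorm D (fun v => xor (xor (incrM G m v) (incrM G (i, x, y) v))
        (xor (incrM G m v) (incrM G (i, y, z) v))) : ℝ) +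
        (cnorm D (fun v => xor (incrM G m v) (incrM G (i, z, x) v)) : ℝ) := by exact_mod_cast h5
  linarith

/-- **Three-cycle + common partners ⇒ small increment**: if `m` shares a good partner `b_t` (on a
block distinct from both) with each move of a three-cycle `x → y → z → x` in block `i`, then
`‖Δ(m)‖ < 12θ·2^{L'}`. -/
theorem cnorm_lt_of_cycle_partners {blk : Fin L → Fin k}
    {G : Fin k → (Fin L → Bool) → (Fin L' → Bool) → Bool} (hG : BlockLocal blk G) {D : ℕ} {θ : ℝ}
    (m : Mv L k) (i : Fin k) (x y z : Fin L → Bool) (b₁ b₂ b₃ : Mv L k)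
    (hm₁ : m.1 ≠ b₁.1) (hm₂ : m.1 ≠ b₂.1) (hm₃ : m.1 ≠ b₃.1)
    (hi₁ : i ≠ b₁.1) (hi₂ : i ≠ b₂.1) (hi₃ : i ≠ b₃.1)
    (g₁ : Good blk G D θ m b₁) (g₁' : Good blk G D θ (i, x, y) b₁)
    (g₂ : Good blk G D θ m b₂) (g₂' : Good blk G D θ (i, y, z) b₂)
    (g₃ : Good blk G D θ m b₃) (g₃' : Good blk G D θ (i, z, x) b₃) :
    (cnorm D (incrM G m) : ℝ) < 12 * θ * (2 : ℝ) ^ L' :=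
  cnorm_lt_of_cycle m i x y z
    (cnorm_xor_lt_of_common_partner hG hm₁ hi₁ g₁ g₁')
    (cnorm_xor_lt_of_common_partner hG hm₂ hi₂ g₂ g₂')
    (cnorm_xor_lt_of_common_partner hG hm₃ hi₃ g₃ g₃')

/-- **Landing step**: a move whose increment has norm `< (c − 1)θ·2^{L'}` applied to a `cθ`-far row
lands on a `θ`-far row. -/
theorem far_bmove_of_cnorm_lt {blk : Fin L → Fin k}
    {G : Fin k → (Fin L → Bool) → (Fin L' → Bool) → Bool} (hG : BlockLocal blk G) {D : ℕ} {θ c : ℝ}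
    {u : Fin L → Bool} (hu : u ∈ far D (gammaBA G) (c * θ)) (i : Fin k) (y : Fin L → Bool)
    (hsmall : (cnorm D (incr G i u y) : ℝ) < (c - 1) * θ * (2 : ℝ) ^ L') :
    bmove blk u i y ∈ far D (gammaBA G) θ := by
  unfold far at hu ⊢
  rw [Finset.mem_filter] at hu ⊢
  refine ⟨Finset.mem_univ _, ?_⟩
  -- Γ u = Γ(u∘m) ⊕ Δ, so φ(u) ≤ φ(u∘m) + ‖Δ‖
  have hΓ : gammaBA G u = fun v => xor (gammaBA G (bmove blk u i y) v) (incr G i u y v) := by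
    rw [gammaBA_bmove hG u i y]
    funext v
    beta_reduce
    cases gammaBA G u v <;> cases incr G i u y v <;> rfl
  have h1 := distFail_xor_le_add_cnorm D (gammaBA G (bmove blk u i y)) (incr G i u y)
  rw [← hΓ] at h1
  have h1' : (distFail D (gammaBA G u) : ℝ) ≤
      (distFail D (gammaBA G (bmove blk u i y)) : ℝ) + (cnorm D (incr G i u y) : ℝ) := by
    exact_mod_cast h1
  have h2 := hu.2
  nlinarith

end BlockAdditive

end Summit.QuantumAdvantage.AdviceFreeQNC0

end
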